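import Literature.RepresentationTheory.Adams2007.CompactDualPairs
import HarnessLib

/-!
# Adams (2007) §6 Prop. 6.6: the vacuum `K̃′`-type determines the vacuum weight

A proved (kernel) consequence of the transcribed dictionary
`Literature.RepresentationTheory.Adams2007.UpUmnTheta.Prop_6_6` of J. Adams, *The theta correspondence
over `ℝ`*, Lect. Notes Ser. Inst. Math. Sci. Natl. Univ. Singap. **12** (2007) 1–39, §6 case II and
Prop. 6.6 [Adams2007Theta] (held text
`book:li2007-harmonic-analysis-group-representations-automorphic-forms-invariant`, chunk p0023 L16–L34): the
CONVERSE of `UpUmnTheta.vacuum_corr`.  If a weight `σ` of `K̃ ⊃ U(p)~` corresponds (`D.corr σ τ′`, "`σ ↔ τ′`",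
Thm 6.3) to the `K̃′`-weight of the constants `τ′_vac = (p/2, …, p/2) ⊗ (−p/2, …, −p/2)`, then `σ` is the weight
of the constants `((m−n)/2, …, (m−n)/2)`: in Prop. 6.6's parametrisation
`τ′ = (a₁, …, a_k, 0, …, 0) ⊗ (0, …, 0, b₁, …, b_ℓ) + (p/2, …) ⊗ (−p/2, …)` with
`a₁ ≥ ⋯ ≥ a_k > 0 > b₁ ≥ ⋯ ≥ b_ℓ`, equality with `τ′_vac` forces `k = ℓ = 0` (for `k > 0` the constraint
`k ≤ m` makes the first `U(m)`-entry `a₁ + p/2 ≠ p/2`; symmetrically for `ℓ`).  Consequence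
(`corr_vacuum_iff`): under Prop. 6.6 the vacuum `K̃′`-type has exactly one partner.

Use (why this is here): for the COMPACT unitary dual pairs `(U(p), U(m, 0))` / `(U(p), U(0, n))` the trivial
representation of the compact `U(m)` (resp. `U(n)`) has lowest — only — `K̃′`-type `τ′_vac`, so the lemma names
the unique genuine character / representation of `U(p)~` it is paired with; the HodgeConjecture (PerL) cell uses the
line `(p; m, n) = (1; 3, 0)`, `(1; 0, 3)` (sign matching at the compact archimedean places of a CM field).
Proved by arithmetic over the dictionary; NOTHING is asserted (no Fock model in the tree; `Prop_6_6` stays a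
hypothesis).  NOT here: any statement about which representations of `U(m,n)` have `τ′_vac` as lowest `K̃′`-type
(that is Thm 6.3(3)–(6) applied to a concrete module, not transcribed in `CompactDualPairs`).
-/

namespace Literature.RepresentationTheory.Adams2007

namespace UpUmnTheta

variable {p m n : ℕ} (D : UpUmnTheta p m n)

/-- **Converse of `vacuum_corr`.**  Under Adams Prop. 6.6: if `σ ↔ (p/2, …, p/2) ⊗ (−p/2, …, −p/2)` (the
`K̃′`-weight of the constants `𝓕⁰`, §6 case II normalisation) then `σ = ((m−n)/2, …, (m−n)/2)` (the `K̃`-weight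
of the constants) — the constraints `a_i > 0 > b_j`, `k ≤ m`, `ℓ ≤ n` of Prop. 6.6 force `k = ℓ = 0`.
Proved. [cite: Adams2007Theta, §6 Prop 6.6] -/
theorem eq_vacuum_of_corr_vacuum (h : D.Prop_6_6) {σ : Fin p → ℚ}
    (hc : D.corr σ (fun _ => (p : ℚ) / 2, fun _ => -((p : ℚ) / 2))) :
    σ = fun _ => ((m : ℚ) - n) / 2 := by
  obtain ⟨P, hσ, hτ⟩ := (h.1 σ _).mp hc
  have hk : P.k = 0 := by
    by_contra hk
    have hkpos : 0 < P.k := Nat.pos_of_ne_zero hk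
    have hm : 0 < m := lt_of_lt_of_le hkpos P.hk
    have e := congrFun (congrArg Prod.fst hτ) ⟨0, hm⟩
    simp only [tauWt, dif_pos hkpos] at e
    have ha := P.a_pos ⟨0, hkpos⟩
    have ha' : (0 : ℚ) < (P.a ⟨0, hkpos⟩ : ℚ) := by exact_mod_cast ha
    linarith
  have hl : P.ℓ = 0 := by
    by_contra hl
    have hlpos : 0 < P.ℓ := Nat.pos_of_ne_zero hl
    have hn : 0 < n := lt_of_lt_of_le hlpos P.hl
    have hle : n - P.ℓ ≤ n - 1 := by omega
    have e := congrFun (congrArg Prod.snd hτ) ⟨n - 1, by omega⟩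
    simp only [tauWt, dif_pos hle] at e
    have hb := P.b_neg ⟨n - 1 - (n - P.ℓ), by omega⟩
    have hb' : ((P.b ⟨n - 1 - (n - P.ℓ), by omega⟩ : ℤ) : ℚ) < 0 := by exact_mod_cast hb
    linarith
  rw [hσ]
  funext i
  have hi : ¬ (p - P.ℓ ≤ i.val) := by rw [hl]; have := i.isLt; omega
  have hi' : ¬ (i.val < P.k) := by rw [hk]; omega
  simp only [sigmaWt, dif_neg hi, dif_neg hi', zero_add]

/-- Under Adams Prop. 6.6 the `K̃′`-weight of the constants `(p/2, …) ⊗ (−p/2, …)` has EXACTLY ONE partner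
`σ`, namely `((m−n)/2, …, (m−n)/2)` (`vacuum_corr` and its converse `eq_vacuum_of_corr_vacuum`).  Proved.
[cite: Adams2007Theta, §6 Prop 6.6] -/
theorem corr_vacuum_iff (h : D.Prop_6_6) (σ : Fin p → ℚ) :
    D.corr σ (fun _ => (p : ℚ) / 2, fun _ => -((p : ℚ) / 2)) ↔ σ = fun _ => ((m : ℚ) - n) / 2 :=
  ⟨D.eq_vacuum_of_corr_vacuum h, fun e => e ▸ D.vacuum_corr h⟩

/-- The line `(p; m, n) = (1; 3, 0)` (the compact pair `(U(1), U(3,0))`): the partner of the constants' `K̃′`-type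
`(1/2, 1/2, 1/2) ⊗ ()` is the genuine character of `U(1)~` of weight `3/2`.  Proved (specialisation of
`corr_vacuum_iff`). [cite: Adams2007Theta, §6 Prop 6.6] -/
theorem corr_vacuum_iff_one_three_zero (D : UpUmnTheta 1 3 0) (h : D.Prop_6_6) (σ : Fin 1 → ℚ) :
    D.corr σ (fun _ => (1 : ℚ) / 2, fun _ => -((1 : ℚ) / 2)) ↔ σ = fun _ => (3 : ℚ) / 2 := by
  have e := D.corr_vacuum_iff h σ
  norm_num at e
  exact e

/-- The line `(p; m, n) = (1; 0, 3)` (the compact pair `(U(1), U(0,3))`): the partner of the constants' `K̃′`-type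
`() ⊗ (−1/2, −1/2, −1/2)` is the genuine character of `U(1)~` of weight `−3/2`.  Proved. [cite: Adams2007Theta, §6 Prop 6.6] -/
theorem corr_vacuum_iff_one_zero_three (D : UpUmnTheta 1 0 3) (h : D.Prop_6_6) (σ : Fin 1 → ℚ) :
    D.corr σ (fun _ => (1 : ℚ) / 2, fun _ => -((1 : ℚ) / 2)) ↔ σ = fun _ => -((3 : ℚ) / 2) := by
  have e := D.corr_vacuum_iff h σ
  norm_num at e
  exact e

end UpUmnTheta

end Literature.RepresentationTheory.Adams2007
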